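import Literature.Computability.Cryptography.PQCLWEProofs
import HarnessLib

/-!
# Discretising torus `LWE` samples: `A_{s,φ} ↦ A_{s,φ̄}` and uniform `↦` uniform (Regev 2009, Lemma 4.3)

Topic `Computability/Cryptography` (family `pqc`), grouping namespace `LWE` (the model of `LWE.lean` /
`LWENoise.lean`). The bridge between the tree's two models of `LWE` samples — the continuous-noise
torus law `torusLWESample q φ s` on `ℤ_qⁿ × 𝕋` (Regev's `A_{s,φ}`) and the discrete law
`lweSample χ s` on `ℤ_qⁿ × ℤ_q` (`A_{s,χ}`) — by rounding the second coordinate (`discretizeCircle`,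
`b ↦ ⌊q b⌉ mod q`):

> **Regev 2009, Lemma 4.3** (discretisation). The map `(a, b) ↦ (a, ⌊q b⌉ mod q)` takes `A_{s,Ψ_α}` to
> `A_{s,Ψ̄_α}` and the uniform distribution on `ℤ_qⁿ × 𝕋` to the uniform distribution on `ℤ_qⁿ × ℤ_q`
> (so `LWE` with noise `Ψ̄_α` is at least as hard as with `Ψ_α`).

This is the last step of every reduction of the decomposition of
`Literature.Computability.Cryptography.blprs_gapSVP_sqrt_dim_to_lwe_classical` (pqc.S21) — and of
pqc.S19/S20 — that manufactures torus samples (BLPRS Cor. 3.2, `LWEModulusSwitchSamples.lean`) but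
must feed an oracle for the DISCRETISED problem (`discretizedGaussian`, the interface of
`LWEHardness.lean`). Everything is PROVED; the one `def` is the rounding map on samples; no named fact.

## Results

* `discretizeSample q = Prod.map id (discretizeCircle q)`, `measurable_discretizeSample`;
  `discretize_natCast_div_add` / `discretizeCircle_coe_div_add` (`⌊q(k/q + t)⌉ = k + ⌊qt⌉`),
  `discretizeCircle_inv_add` (shift by `1/q` adds `1`).
* **`torusLWESample_map_discretizeSample`**: if `φ ∘ ⌊q·⌉⁻¹ = χ` then
  `(A_{s,φ}) ∘ discretizeSample⁻¹ = A_{s,χ}` EXACTLY (as measures); the Gaussian case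
  `torusLWESample_wrappedGaussian_map_discretizeSample` (`Ψ_α ↦ Ψ̄_α`, tree bridge
  `discretizedGaussian_eq_map_wrappedGaussian`).
* **`volume_map_discretizeCircle`**: Haar measure on `𝕋` rounds to the uniform law on `ℤ_q` (the `q`
  fibres are translates by `1/q`, `preimage_discretizeCircle_eq`, hence of equal measure, and partition
  `𝕋`); `uniformOfFintype_toMeasure_prod`; **`uniform_prod_volume_map_discretizeSample`**:
  `U(ℤ_qⁿ) ⊗ Haar ↦ U(ℤ_qⁿ × ℤ_q)`.

## References

* O. Regev, *On lattices, learning with errors, random linear codes, and cryptography*, J. ACM 56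
  (2009), art. 34, §2 (`Ψ_α`, `Ψ̄_α`, `A_{s,φ}`) and Lemma 4.3 [RegevLWE2009].
* Z. Brakerski, A. Langlois, C. Peikert, O. Regev, D. Stehlé, *Classical hardness of learning with
  errors*, STOC 2013, p. 13 (the chain ends in dimension `n` with modulus `q`) [BrakerskiEtAl2013].
-/

noncomputable section

open MeasureTheory ProbabilityTheory
open scoped ENNReal

namespace Literature.Computability.Cryptography

namespace LWE

variable {ι : Type} [Fintype ι] [DecidableEq ι] (q : ℕ) [NeZero q]

/-! ### The discretisation of a sample -/

/-- Discretising the second coordinate of a torus sample: `(a, b) ↦ (a, ⌊q b⌉ mod q)` (Regev's passage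
from `A_{s,Ψ_α}` to `A_{s,Ψ̄_α}`, applied samplewise). [cite: RegevLWE2009, Lemma 4.3] -/
def discretizeSample : (ι → ZMod q) × UnitAddCircle → (ι → ZMod q) × ZMod q :=
  Prod.map id (discretizeCircle q)

omit [Fintype ι] [DecidableEq ι] [NeZero q] in
/-- `discretizeSample` is measurable. [folklore] -/
theorem measurable_discretizeSample : Measurable (discretizeSample (ι := ι) q) :=
  measurable_id.prodMap (measurable_discretizeCircle q)

/-- `⌊q (k/q + t)⌉ = k + ⌊q t⌉ (mod q)`: an integer phase passes through the rounding. [folklore] -/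
theorem discretize_natCast_div_add (k : ℕ) (t : ℝ) :
    discretize q ((k : ℝ) / q + t) = (k : ZMod q) + discretize q t := by
  have hq : (q : ℝ) ≠ 0 := by exact_mod_cast NeZero.ne q
  unfold discretize
  rw [mul_add, mul_div_cancel₀ _ hq, round_natCast_add]
  push_cast
  rfl

/-- On the torus: `discretizeCircle (k/q + b) = k + discretizeCircle b`. [folklore] -/
theorem discretizeCircle_coe_div_add (k : ℕ) (b : UnitAddCircle) :
    discretizeCircle q ((((k : ℝ) / q : ℝ) : UnitAddCircle) + b) = (k : ZMod q) + discretizeCircle q b := by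
  induction b using QuotientAddGroup.induction_on with
  | H t => rw [← AddCircle.coe_add, discretizeCircle_coe, discretizeCircle_coe, discretize_natCast_div_add]

/-- Shifting by `1/q` on the torus shifts the discretisation by `1`. [folklore] -/
theorem discretizeCircle_inv_add (b : UnitAddCircle) :
    discretizeCircle q ((((1 : ℝ) / q : ℝ) : UnitAddCircle) + b) = 1 + discretizeCircle q b := by
  have h := discretizeCircle_coe_div_add q 1 b
  rwa [Nat.cast_one, Nat.cast_one] at h

/-! ### `A_{s,φ}` discretised is `A_{s,φ̄}` (exactly) -/

/-- **Regev 2009, Lemma 4.3 (the exact identity behind it).** If `χ` on `ℤ_q` is the discretisation of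
the torus noise `φ` (`χ = φ ∘ discretizeCircle⁻¹`, e.g. `Ψ̄_α` for `φ = Ψ_α`,
`discretizedGaussian_eq_map_wrappedGaussian`), then discretising the second coordinate of `A_{s,φ}`
gives EXACTLY the discrete sample law `A_{s,χ}` (`lweSample χ s`): `⌊q(⟨a,s⟩/q + e)⌉ = ⟨a,s⟩ + ⌊qe⌉`.
[cite: RegevLWE2009, Lemma 4.3] -/
theorem torusLWESample_map_discretizeSample (φ : Measure UnitAddCircle) [IsProbabilityMeasure φ]
    (χ : PMF (ZMod q)) (hχ : φ.map (discretizeCircle q) = χ.toMeasure) (s : ι → ZMod q) :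
    (torusLWESample q φ s).map (discretizeSample q) = (lweSample χ s).toMeasure := by
  refine Measure.ext_iff_singleton.2 fun p => ?_
  obtain ⟨a₀, k⟩ := p
  rw [Measure.map_apply (measurable_discretizeSample q) (measurableSet_singleton _), torusLWESample,
    Measure.map_apply (measurable_torusSampleMap q s)
      ((measurable_discretizeSample q) (measurableSet_singleton _)),
    PMF.toMeasure_apply_singleton _ _ (measurableSet_singleton _), lweSample_mass]
  -- the preimage is the box `{a₀} × discretizeCircle⁻¹{k - ⟨a₀, s⟩}`
  have hset : torusSampleMap q s ⁻¹' (discretizeSample q ⁻¹' {(a₀, k)}) =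
      {a₀} ×ˢ (discretizeCircle q ⁻¹' {k - a₀ ⬝ᵥ s}) := by
    ext ⟨a, e⟩
    simp only [Set.mem_preimage, torusSampleMap, discretizeSample, Prod.map_apply, id_eq,
      Set.mem_singleton_iff, Prod.mk.injEq, Set.mem_prod]
    constructor
    · rintro ⟨rfl, hk⟩
      refine ⟨rfl, ?_⟩
      rw [discretizeCircle_coe_div_add, ZMod.natCast_zmod_val] at hk
      rw [← hk]
      abel
    · rintro ⟨rfl, hk⟩
      refine ⟨rfl, ?_⟩
      rw [discretizeCircle_coe_div_add, ZMod.natCast_zmod_val, hk]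
      abel
  rw [hset, Measure.prod_prod, PMF.toMeasure_apply_singleton _ _ (measurableSet_singleton _),
    PMF.uniformOfFintype_apply, ← Measure.map_apply (measurable_discretizeCircle q) (measurableSet_singleton _),
    hχ, PMF.toMeasure_apply_singleton _ _ (measurableSet_singleton _), Fintype.card_fun]
  push_cast
  rfl

/-- The Gaussian case: discretising `A_{s,Ψ_α}` gives `A_{s,Ψ̄_α}`. [cite: RegevLWE2009, Lemma 4.3] -/
theorem torusLWESample_wrappedGaussian_map_discretizeSample (α : ℝ) (s : ι → ZMod q) :
    (torusLWESample q (wrappedGaussian α) s).map (discretizeSample q) =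
      (lweSample (discretizedGaussian q α) s).toMeasure :=
  torusLWESample_map_discretizeSample q _ _ (discretizedGaussian_eq_map_wrappedGaussian q α).symm s

/-! ### The uniform sample stays uniform -/

/-- The fibres of the discretisation over `𝕋` are translates of one another by `1/q`. [folklore] -/
theorem preimage_discretizeCircle_eq (k : ZMod q) :
    discretizeCircle q ⁻¹' {k} =
      (fun b : UnitAddCircle => (((1 : ℝ) / q : ℝ) : UnitAddCircle) + b) ⁻¹' (discretizeCircle q ⁻¹' {1 + k}) := by
  ext b
  simp only [Set.mem_preimage, Set.mem_singleton_iff]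
  rw [discretizeCircle_inv_add, add_right_inj]

/-- **Haar measure discretises to the uniform law on `ℤ_q`**: each fibre `{b | ⌊qb⌉ ≡ k}` has measure
`1/q` (they are `q` translates partitioning `𝕋`). [cite: RegevLWE2009, Lemma 4.3 ("the uniform distribution is mapped to the uniform distribution")] -/
theorem volume_map_discretizeCircle :
    (volume : Measure UnitAddCircle).map (discretizeCircle q) = (PMF.uniformOfFintype (ZMod q)).toMeasure := by
  refine Measure.ext_iff_singleton.2 fun k => ?_
  rw [Measure.map_apply (measurable_discretizeCircle q) (measurableSet_singleton _),
    PMF.toMeasure_apply_singleton _ _ (measurableSet_singleton _), PMF.uniformOfFintype_apply, ZMod.card]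
  -- all fibres have the same measure
  have hstep : ∀ j : ZMod q, volume (discretizeCircle q ⁻¹' {j}) = volume (discretizeCircle q ⁻¹' {1 + j}) := by
    intro j
    conv_lhs => rw [preimage_discretizeCircle_eq q j]
    exact measure_preimage_add _ _ _
  have hall : ∀ j : ZMod q, volume (discretizeCircle q ⁻¹' {j}) = volume (discretizeCircle q ⁻¹' {0}) := by
    intro j
    rw [← ZMod.natCast_zmod_val j]
    induction j.val with
    | zero => rw [Nat.cast_zero]
    | succ n ih => rw [Nat.cast_succ, add_comm, ← hstep, ih]
  -- and they partition the torus
  have hsum : ∑ j : ZMod q, volume (discretizeCircle q ⁻¹' {j}) = 1 := by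
    rw [sum_measure_preimage_singleton _ fun j _ => (measurable_discretizeCircle q) (measurableSet_singleton j)]
    simp
  simp_rw [hall] at hsum
  rw [Finset.sum_const, Finset.card_univ, ZMod.card, nsmul_eq_mul] at hsum
  rw [hall k]
  exact ENNReal.eq_inv_of_mul_eq_one_left (by rwa [mul_comm] at hsum)

omit [NeZero q] in
/-- The uniform law on a product of finite types is the product of the uniform laws (as measures).
[folklore] -/
theorem uniformOfFintype_toMeasure_prod {A B : Type*} [Fintype A] [Fintype B] [Nonempty A] [Nonempty B]
    [MeasurableSpace A] [MeasurableSingletonClass A] [MeasurableSpace B] [MeasurableSingletonClass B] :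
    (PMF.uniformOfFintype A).toMeasure.prod (PMF.uniformOfFintype B).toMeasure =
      (PMF.uniformOfFintype (A × B)).toMeasure := by
  refine Measure.ext_iff_singleton.2 fun p => ?_
  obtain ⟨a, b⟩ := p
  rw [← Set.singleton_prod_singleton, Measure.prod_prod,
    PMF.toMeasure_apply_singleton _ _ (measurableSet_singleton _),
    PMF.toMeasure_apply_singleton _ _ (measurableSet_singleton _), Set.singleton_prod_singleton,
    PMF.toMeasure_apply_singleton _ _ (measurableSet_singleton _), PMF.uniformOfFintype_apply,
    PMF.uniformOfFintype_apply, PMF.uniformOfFintype_apply, Fintype.card_prod, Nat.cast_mul,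
    ENNReal.mul_inv (Or.inl (by exact_mod_cast Fintype.card_ne_zero)) (Or.inl (ENNReal.natCast_ne_top _))]

/-- **A uniform torus sample discretises to a uniform discrete sample**: `U(ℤ_qⁿ) ⊗ Haar(𝕋) ↦ U(ℤ_qⁿ × ℤ_q)`.
[cite: RegevLWE2009, Lemma 4.3] -/
theorem uniform_prod_volume_map_discretizeSample :
    ((PMF.uniformOfFintype (ι → ZMod q)).toMeasure.prod (volume : Measure UnitAddCircle)).map
        (discretizeSample q) =
      (PMF.uniformOfFintype ((ι → ZMod q) × ZMod q)).toMeasure := by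
  rw [discretizeSample, ← Measure.map_prod_map _ _ measurable_id (measurable_discretizeCircle q),
    Measure.map_id, volume_map_discretizeCircle, uniformOfFintype_toMeasure_prod]

end LWE

end Literature.Computability.Cryptography

end
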